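import Literature.Computability.Complexity.GateEliminationStep

/-!
# Gate elimination, III: rdq-sources in use — Prop. 2.4, the output gate, and constant substitutions

Toolkit for the proof of the one-step claim `LiYang2022_step` (Li–Yang, STOC 2022, Thm. 4.1;
full version ECCC TR21-023, §4.1), over the state space `Semicircuit` / `RdqSource` /
`Semicircuit.measure` of `GateEliminationStep.lean`. Everything here is PROVED; no new named
facts.

* **Prop. 2.4** (ECCC Prop. 2.3), `RdqSource.exists_affineSubspace_subset_sol`: an rdq-source of
  dimension `D` with `q` quadratic equations contains a nonempty affine subspace of `𝔽₂ⁿ` of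
  dimension `≥ D - q`, and `2q ≤ D` (read-once); the subspace is the explicit
  `RdqSource.canSubspace` (kept free variables as parameters, the first variable of every
  quadratic equation pinned to its shift, linear variables solved). Hence an affine disperser for
  dimension `d` is not constant on `Sol R` once `dim R ≥ 2d` (`IsAffineDisperser.exists_ne_of_sol`),
  and not a function of one coordinate once `dim R ≥ 2d + 2`
  (`IsAffineDisperser.exists_ne_of_sol_coord`, via the codimension-one lemma
  `exists_le_coord_const`).
* **The output is a gate**, `Semicircuit.exists_out_eq_gate`: a fair semicircuit computing
  `f|_R` for such `f`, `R` has a gate as output node (so `g ≥ 1`; the degenerate circuits of the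
  state space need no separate treatment in the case analysis).
* **Substitutions on the source side** (§2.4): `LinEq.substVar` (unfolding `x_l := E'` in an
  affine expression, symmetric difference of supports over `𝔽₂`), `QuadEq.linearize` (a
  quadratic equation under `x_j := b` becomes affine), `RdqSource.setLin` (a quadratic variable
  becomes linear), `RdqSource.assignFree` / `RdqSource.assignProtected` (the constant
  substitution `x_j := b` to an unprotected / protected free variable), with their solution sets
  (`Sol' = Sol ∩ {x_j = b}`), dimensions (`dim' + 1 = dim`), quadratic counts (`q' = q`, resp.
  `q' + 1 = q`) and protected variables.
* **Constant substitution in the circuit** (§2.4, Prop. 2.6 for constant substitutions),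
  `Semicircuit.substConst`: wires from `x_j` are moved to the constant node `b`. Proved: fairness
  is preserved (`Fair.substConst`), `C[x_j := b]` computes `f|_{R'}` for the restricted source
  (`ComputesRestr.substConst`, `….substConst_assignFree`, `….substConst_assignProtected`),
  `x_j` becomes a `0`-variable and other out-degrees are unchanged, the troubled gates afterwards
  are the old ones not reading `x_j` (`troubled_substConst_iff`), the packs whose gates stay
  troubled form a packing with **no larger potential** (`potential_substConst_le`: dropped packs
  inject into un-troubled gates), the influential inputs afterwards are among the old ones minus
  `x_j` (`influential_substConst_subset`), and the measure bookkeeping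
  `μ(C', 𝒫', R') ≤ μ(C, 𝒫, R) - α_I (i - i') - α_Q (q - q')` (`measure_substConst_le`).

The gates made trivial or degenerate by the constant are NOT removed here: that is the job of
the normalization rules (Li–Yang §3.3, Lemma 3.11), the next layer of the toolkit.

## References

* J. Li, T. Yang, *3.1n − o(n) circuit lower bounds for explicit functions*, STOC 2022
  [LiYang2022]: Def. 2.2, §2.3 (computing `f|_R`), Prop. 2.4 (ECCC TR21-023 Prop. 2.3, p. 9),
  §2.4 (substitutions, pp. 9–10), Prop. 2.6, Def. 3.1–3.6; full version ECCC TR21-023.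
* M. G. Find, A. Golovnev, E. A. Hirsch, A. S. Kulikov, *A better-than-3n lower bound for the
  circuit complexity of an explicit function*, FOCS 2016 (rdq-sources).
-/

namespace Literature.Computability.Complexity

open Finset Module


/-- Inside a nonempty affine subspace `A` of `𝔽₂ⁿ` (indeed of `K^ι`) and for a coordinate `j`,
there is a nonempty affine subspace `A' ≤ A` of codimension at most one in `A` on which the
`j`-th coordinate is constant (the fibre through a point of `A` of the coordinate map restricted
to the direction). [folklore] -/
theorem exists_le_coord_const {K : Type*} [Field K] {ι : Type*} [Fintype ι]
    (A : AffineSubspace K (ι → K)) (hA : (A : Set (ι → K)).Nonempty) (j : ι) :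
    ∃ A' : AffineSubspace K (ι → K), A' ≤ A ∧ (A' : Set (ι → K)).Nonempty ∧
      finrank K A.direction ≤ finrank K A'.direction + 1 ∧
      ∀ u ∈ A', ∀ v ∈ A', u j = v j := by
  obtain ⟨p, hp⟩ := hA
  set E := A.direction with hE
  set f : E →ₗ[K] K := (LinearMap.proj j).comp E.subtype with hf
  set S : Submodule K (ι → K) := (LinearMap.ker f).map E.subtype with hS
  refine ⟨AffineSubspace.mk' p S, ?_, ⟨p, AffineSubspace.self_mem_mk' p S⟩, ?_, ?_⟩
  · intro x hx
    have hx' : x -ᵥ p ∈ S := AffineSubspace.mem_mk'.mp hx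
    have hxE : x -ᵥ p ∈ E := by
      obtain ⟨y, -, hy⟩ := Submodule.mem_map.mp hx'
      rw [← hy]
      exact y.2
    have := AffineSubspace.vadd_mem_of_mem_direction hxE hp
    rwa [vsub_vadd] at this
  · rw [AffineSubspace.direction_mk', hS, Submodule.finrank_map_subtype_eq]
    have h1 := LinearMap.finrank_range_add_finrank_ker f
    have h2 : finrank K (LinearMap.range f) ≤ 1 := by
      have := (LinearMap.range f).finrank_le
      rwa [Module.finrank_self] at this
    omega
  · have key : ∀ u ∈ AffineSubspace.mk' p S, u j = p j := by
      intro u hu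
      have hu' : u -ᵥ p ∈ S := AffineSubspace.mem_mk'.mp hu
      obtain ⟨y, hy, hyu⟩ := Submodule.mem_map.mp hu'
      have hy0 : f y = 0 := LinearMap.mem_ker.mp hy
      have : (u -ᵥ p) j = 0 := by
        rw [← hyu]
        simpa [hf] using hy0
      rw [vsub_eq_sub, Pi.sub_apply, sub_eq_zero] at this
      exact this
    intro u hu v hv
    rw [key u hu, key v hv]


namespace RdqSource

variable {n : ℕ} (R : RdqSource n)

/-! ### Pinned variables and the canonical affine subspace of an rdq-source (Li–Yang Prop. 2.3/2.4) -/

/-- `x_j` is *pinned* by `R`: it is the first free variable read by some quadratic equation of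
`R` (the variable "`x_i`" to which Li–Yang assign a constant in the proof of Prop. 2.4 of the
STOC version = Prop. 2.3 of ECCC TR21-023, turning the quadratic equation into an affine one).
[cite: LiYang2022, Prop. 2.4] -/
def Pinned (j : Fin n) : Prop := ∃ l : Fin n, (R.quad l).map QuadEq.i = some j

/-- Being pinned is decidable. [folklore] -/
instance instDecidablePredPinned : DecidablePred R.Pinned := fun j => by
  unfold Pinned; infer_instance

variable {R} in
/-- A pinned variable, unfolded: some quadratic equation has it as first variable. [folklore] -/
theorem pinned_iff {j : Fin n} : R.Pinned j ↔ ∃ (l : Fin n) (e : QuadEq n), R.quad l = some e ∧ e.i = j := by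
  constructor
  · rintro ⟨l, hl⟩
    cases hq : R.quad l with
    | none => simp [hq] at hl
    | some e => exact ⟨l, e, hq, by simpa [hq] using hl⟩
  · rintro ⟨l, e, hl, rfl⟩
    exact ⟨l, by simp [hl]⟩

variable {R} in
/-- The first variable of a quadratic equation is pinned. [folklore] -/
theorem pinned_of_quad {l : Fin n} {e : QuadEq n} (h : R.quad l = some e) : R.Pinned e.i :=
  pinned_iff.mpr ⟨l, e, h, rfl⟩

variable {R} in
/-- A pinned variable is free. [folklore] -/
theorem Pinned.free {j : Fin n} (h : R.Pinned j) : R.Free j := by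
  obtain ⟨l, e, hl, rfl⟩ := pinned_iff.mp h
  exact (R.quad_wf l e hl).1

variable {R} in
/-- Read-once: the quadratic equation pinning a variable is unique. [folklore] -/
theorem quad_unique_of_i_eq {l l' : Fin n} {e e' : QuadEq n} (h : R.quad l = some e)
    (h' : R.quad l' = some e') (hi : e.i = e'.i) : l = l' ∧ e = e' := by
  by_cases hll : l = l'
  · subst hll
    rw [h] at h'
    exact ⟨rfl, Option.some.inj h'⟩
  · exact absurd hi (R.read_once l l' e e' h h' hll).1

/-- The shift `c₁` of the quadratic equation pinning `x_j` (junk `0` if `x_j` is not pinned).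
[folklore] -/
noncomputable def pinShift (j : Fin n) : ZMod 2 :=
  if h : R.Pinned j then ((R.quad (Classical.choose h)).map QuadEq.c₁).getD 0 else 0

variable {R} in
/-- The shift of the pinning equation. [folklore] -/
theorem pinShift_eq {l : Fin n} {e : QuadEq n} (h : R.quad l = some e) : R.pinShift e.i = e.c₁ := by
  have hp : R.Pinned e.i := pinned_of_quad h
  unfold pinShift
  rw [dif_pos hp]
  obtain ⟨e', hq, hi⟩ := Option.map_eq_some_iff.mp (Classical.choose_spec hp)
  obtain ⟨-, hee⟩ := quad_unique_of_i_eq h hq hi.symm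
  rw [hq, ← hee]
  rfl

/-- The *kept* coordinates of the canonical subspace: the free variables that are not pinned.
[cite: LiYang2022, Prop. 2.4] -/
def kept : Finset (Fin n) := univ.filter fun j => R.Free j ∧ ¬ R.Pinned j

variable {R} in
/-- Membership in `kept`. [folklore] -/
@[simp] theorem mem_kept {j : Fin n} : j ∈ R.kept ↔ R.Free j ∧ ¬ R.Pinned j := by
  simp [kept]

/-- The coordinate functional of a kept variable on the parameter space `kept → 𝔽₂`
(zero for the other variables). [folklore] -/
noncomputable def projKept (i : Fin n) : (R.kept → ZMod 2) →ₗ[ZMod 2] ZMod 2 :=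
  if h : i ∈ R.kept then LinearMap.proj (⟨i, h⟩ : R.kept) else 0

/-- The linear part of row `j` of the canonical parametrization: the coordinate for a variable
without affine equation, the sum over the support for a linear variable. [folklore] -/
noncomputable def rowL (j : Fin n) : (R.kept → ZMod 2) →ₗ[ZMod 2] ZMod 2 :=
  match R.lin j with
  | none => R.projKept j
  | some e => ∑ i ∈ e.support, R.projKept i

/-- The linear part of the canonical parametrization. [folklore] -/
noncomputable def canL : (R.kept → ZMod 2) →ₗ[ZMod 2] (Fin n → ZMod 2) :=
  LinearMap.pi R.rowL

/-- The constant value of a variable without affine equation on the canonical subspace: `0` for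
a kept variable, the shift `c₁` for a pinned one, `c₃` for a quadratic one. [folklore] -/
noncomputable def coord0 (i : Fin n) : ZMod 2 :=
  if R.Pinned i then R.pinShift i else match R.quad i with
    | some e => e.c₃
    | none => 0

/-- The base point of the canonical parametrization. [folklore] -/
noncomputable def can0 (j : Fin n) : ZMod 2 :=
  match R.lin j with
  | none => R.coord0 j
  | some e => e.c + ∑ i ∈ e.support, R.coord0 i

/-- **The canonical parametrization** of an rdq-source (proof of Li–Yang Prop. 2.4 = ECCC
Prop. 2.3): the kept free variables are the parameters, every pinned variable `x_i` is set to the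
shift `c₁` of its quadratic equation (so that the equation becomes `x_l = c₃`), and the linear
variables are then determined by their affine equations. [cite: LiYang2022, Prop. 2.4] -/
noncomputable def canMap : (R.kept → ZMod 2) →ᵃ[ZMod 2] (Fin n → ZMod 2) :=
  ⟨fun u => R.canL u + R.can0, R.canL, fun p v => by
    rw [vadd_eq_add, vadd_eq_add, map_add, add_assoc]⟩

/-- **The canonical affine subspace** `R.canSubspace ⊆ Sol R` of an rdq-source, of dimension
`|kept| ≥ dim R - q` (Li–Yang Prop. 2.4). [cite: LiYang2022, Prop. 2.4] -/
noncomputable def canSubspace : AffineSubspace (ZMod 2) (Fin n → ZMod 2) :=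
  (⊤ : AffineSubspace (ZMod 2) (R.kept → ZMod 2)).map R.canMap

variable {R}

/-- Coordinates of the linear part. [folklore] -/
theorem canL_apply (u : R.kept → ZMod 2) (j : Fin n) : R.canL u j = R.rowL j u := by
  simp [canL]

/-- Coordinates of the canonical parametrization. [folklore] -/
theorem canMap_apply (u : R.kept → ZMod 2) (j : Fin n) : R.canMap u j = R.rowL j u + R.can0 j := by
  change (R.canL u + R.can0) j = _
  rw [Pi.add_apply, canL_apply]

/-- The coordinate functional at a kept variable. [folklore] -/
theorem projKept_apply_of_mem (u : R.kept → ZMod 2) {i : Fin n} (h : i ∈ R.kept) :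
    R.projKept i u = u ⟨i, h⟩ := by
  simp [projKept, h]

/-- The coordinate functional vanishes at a variable that is not kept. [folklore] -/
theorem projKept_apply_of_not_mem (u : R.kept → ZMod 2) {i : Fin n} (h : i ∉ R.kept) :
    R.projKept i u = 0 := by
  simp [projKept, h]

/-- Row of a variable without affine equation. [folklore] -/
theorem rowL_of_lin_none {j : Fin n} (h : R.lin j = none) : R.rowL j = R.projKept j := by
  simp [rowL, h]

/-- Row of a linear variable. [folklore] -/
theorem rowL_of_lin_some {j : Fin n} {e : LinEq n} (h : R.lin j = some e) :
    R.rowL j = ∑ i ∈ e.support, R.projKept i := by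
  simp [rowL, h]

/-- Base point at a variable without affine equation. [folklore] -/
theorem can0_of_lin_none {j : Fin n} (h : R.lin j = none) : R.can0 j = R.coord0 j := by
  simp [can0, h]

/-- Base point at a linear variable. [folklore] -/
theorem can0_of_lin_some {j : Fin n} {e : LinEq n} (h : R.lin j = some e) :
    R.can0 j = e.c + ∑ i ∈ e.support, R.coord0 i := by
  simp [can0, h]

/-- A variable without affine equation takes the value `projKept + coord0`. [folklore] -/
theorem canMap_apply_of_lin_none (u : R.kept → ZMod 2) {j : Fin n} (h : R.lin j = none) :
    R.canMap u j = R.projKept j u + R.coord0 j := by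
  rw [canMap_apply, rowL_of_lin_none h, can0_of_lin_none h]

/-- A kept variable returns its parameter. [folklore] -/
theorem canMap_apply_of_mem (u : R.kept → ZMod 2) {j : Fin n} (h : j ∈ R.kept) :
    R.canMap u j = u ⟨j, h⟩ := by
  have hj := mem_kept.mp h
  rw [canMap_apply_of_lin_none u hj.1.1, projKept_apply_of_mem u h]
  unfold coord0
  rw [if_neg hj.2, hj.1.2, add_zero]

/-- The linear part at a kept variable returns the parameter. [folklore] -/
theorem canL_apply_of_mem (u : R.kept → ZMod 2) {j : Fin n} (h : j ∈ R.kept) :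
    R.canL u j = u ⟨j, h⟩ := by
  have hj := mem_kept.mp h
  rw [canL_apply, rowL_of_lin_none hj.1.1, projKept_apply_of_mem u h]

/-- The linear part of the canonical parametrization is injective. [folklore] -/
theorem canL_injective : Function.Injective R.canL := by
  intro u v h
  funext ⟨j, hj⟩
  have := congrFun h j
  rwa [canL_apply_of_mem u hj, canL_apply_of_mem v hj] at this

/-- Membership in the canonical subspace. [folklore] -/
theorem mem_canSubspace_iff {w : Fin n → ZMod 2} :
    w ∈ R.canSubspace ↔ ∃ u : R.kept → ZMod 2, R.canMap u = w := by
  unfold canSubspace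
  rw [AffineSubspace.mem_map]
  constructor
  · rintro ⟨u, -, hu⟩; exact ⟨u, hu⟩
  · rintro ⟨u, hu⟩; exact ⟨u, AffineSubspace.mem_top _ _ _, hu⟩

/-- The canonical subspace is nonempty. [folklore] -/
theorem canSubspace_nonempty : (R.canSubspace : Set (Fin n → ZMod 2)).Nonempty :=
  ⟨R.canMap 0, mem_canSubspace_iff.mpr ⟨0, rfl⟩⟩

/-- **Dimension of the canonical subspace**: the number of kept variables. [cite: LiYang2022, Prop. 2.4] -/
theorem finrank_canSubspace :
    finrank (ZMod 2) R.canSubspace.direction = R.kept.card := by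
  unfold canSubspace
  rw [AffineSubspace.map_direction, AffineSubspace.direction_top, Submodule.map_top]
  change finrank (ZMod 2) (LinearMap.range R.canL) = R.kept.card
  rw [LinearMap.finrank_range_of_inj canL_injective, finrank_fintype_fun_eq_card, Fintype.card_coe]

/-- A quadratic variable is not pinned (pinned variables are free). [folklore] -/
theorem not_pinned_of_quad {l : Fin n} {e : QuadEq n} (h : R.quad l = some e) : ¬ R.Pinned l := by
  intro hp
  have := hp.free.2
  rw [h] at this
  exact Option.some_ne_none _ this

/-- A pinned variable takes the value of its shift on the canonical subspace. [folklore] -/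
theorem canMap_apply_i (u : R.kept → ZMod 2) {l : Fin n} {e : QuadEq n} (h : R.quad l = some e) :
    R.canMap u e.i = e.c₁ := by
  have hp : R.Pinned e.i := pinned_of_quad h
  have hfree := (R.quad_wf l e h).1
  have hnot : e.i ∉ R.kept := fun hk => (mem_kept.mp hk).2 hp
  rw [canMap_apply_of_lin_none u hfree.1, projKept_apply_of_not_mem u hnot, zero_add]
  unfold coord0
  rw [if_pos hp, pinShift_eq h]

/-- A quadratic variable takes the value `c₃` on the canonical subspace. [folklore] -/
theorem canMap_apply_quad (u : R.kept → ZMod 2) {l : Fin n} {e : QuadEq n} (h : R.quad l = some e) :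
    R.canMap u l = e.c₃ := by
  have hlin : R.lin l = none := by
    rcases R.lin_or_quad l with h' | h'
    · exact h'
    · rw [h] at h'; exact absurd h' (Option.some_ne_none _)
  have hnot : l ∉ R.kept := fun hk => by
    have := (mem_kept.mp hk).1.2
    rw [h] at this
    exact Option.some_ne_none _ this
  rw [canMap_apply_of_lin_none u hlin, projKept_apply_of_not_mem u hnot, zero_add]
  unfold coord0
  rw [if_neg (not_pinned_of_quad h), h]

/-- **The canonical subspace lies in the solution set of the source.** [cite: LiYang2022, Prop. 2.4] -/
theorem canMap_mem_sol (u : R.kept → ZMod 2) : R.canMap u ∈ R.Sol := by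
  have h2 : ∀ a : ZMod 2, a + a = 0 := by decide
  refine ⟨fun j e hj => ?_, fun l e hl => ?_⟩
  · rw [canMap_apply, rowL_of_lin_some hj, can0_of_lin_some hj, LinearMap.sum_apply]
    have hsum : ∑ i ∈ e.support, R.canMap u i = ∑ i ∈ e.support, (R.projKept i u + R.coord0 i) :=
      Finset.sum_congr rfl fun i hi => canMap_apply_of_lin_none u (R.lin_wf j e hj i hi)
    rw [hsum, Finset.sum_add_distrib]
    ring
  · rw [canMap_apply_quad u hl, canMap_apply_i u hl, h2, zero_mul, zero_add]

/-- The canonical subspace is contained in `Sol R`. [cite: LiYang2022, Prop. 2.4] -/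
theorem canSubspace_subset_sol : (R.canSubspace : Set (Fin n → ZMod 2)) ⊆ R.Sol := by
  intro w hw
  obtain ⟨u, rfl⟩ := mem_canSubspace_iff.mp hw
  exact canMap_mem_sol u


/-! #### Counting: `dim R ≤ |kept| + q` and `2q ≤ dim R` -/

variable (R) in
/-- The first variable of the quadratic equation of `l` (junk `l` if there is none). [folklore] -/
def firstVar (l : Fin n) : Fin n := ((R.quad l).map QuadEq.i).getD l

/-- The pinned variables are the first variables of the quadratic variables. [folklore] -/
theorem filter_pinned_subset_image :
    (univ.filter fun j => R.Pinned j) ⊆ (univ.filter fun l => (R.quad l).isSome).image R.firstVar := by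
  intro j hj
  rw [mem_filter] at hj
  obtain ⟨l, e, hl, rfl⟩ := pinned_iff.mp hj.2
  refine mem_image.mpr ⟨l, mem_filter.mpr ⟨mem_univ _, by simp [hl]⟩, ?_⟩
  simp [firstVar, hl]

/-- There are at most `q` pinned variables. [folklore] -/
theorem card_filter_pinned_le : (univ.filter fun j => R.Pinned j).card ≤ R.quadCount :=
  (card_le_card filter_pinned_subset_image).trans card_image_le

/-- **`dim R ≤ |kept| + q`**: the kept variables are the free ones minus at most `q` pinned ones.
[cite: LiYang2022, Prop. 2.4] -/
theorem dim_le_card_kept_add_quadCount : R.dim ≤ R.kept.card + R.quadCount := by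
  have hsplit := card_filter_add_card_filter_not (s := univ.filter fun j => R.Free j)
    (fun j => R.Pinned j)
  have h1 : ((univ.filter fun j => R.Free j).filter fun j => R.Pinned j).card ≤ R.quadCount := by
    refine le_trans (card_le_card ?_) card_filter_pinned_le
    intro j hj
    simp only [mem_filter, mem_univ, true_and] at hj ⊢
    exact hj.2
  have h2 : ((univ.filter fun j => R.Free j).filter fun j => ¬ R.Pinned j) = R.kept := by
    ext j
    simp [kept]
  unfold dim
  rw [h2] at hsplit
  omega

variable (R) in
/-- The two free variables read by the quadratic equation of `l` (empty if there is none). [folklore] -/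
def quadVars (l : Fin n) : Finset (Fin n) :=
  match R.quad l with
  | some e => {e.i, e.k}
  | none => ∅

/-- A quadratic equation reads two distinct free variables. [folklore] -/
theorem card_quadVars {l : Fin n} {e : QuadEq n} (h : R.quad l = some e) : (R.quadVars l).card = 2 := by
  unfold quadVars
  rw [h, card_pair (R.quad_wf l e h).2.2]

/-- The variables read by quadratic equations are free. [folklore] -/
theorem quadVars_subset (l : Fin n) : R.quadVars l ⊆ univ.filter fun j => R.Free j := by
  unfold quadVars
  cases h : R.quad l with
  | none => simp
  | some e =>
    intro j hj
    simp only [mem_insert, mem_singleton] at hj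
    simp only [mem_filter, mem_univ, true_and]
    rcases hj with rfl | rfl
    · exact (R.quad_wf l e h).1
    · exact (R.quad_wf l e h).2.1

/-- Read-once: distinct quadratic equations read disjoint pairs of variables. [folklore] -/
theorem disjoint_quadVars {l l' : Fin n} (hll : l ≠ l') : Disjoint (R.quadVars l) (R.quadVars l') := by
  unfold quadVars
  cases h : R.quad l with
  | none => simp
  | some e =>
    cases h' : R.quad l' with
    | none => simp
    | some e' =>
      have hr := R.read_once l l' e e' h h' hll
      simp only [disjoint_insert_right, mem_insert, mem_singleton, disjoint_singleton_right, not_or]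
      exact ⟨⟨hr.1.symm, hr.2.2.1.symm⟩, hr.2.1.symm, hr.2.2.2.symm⟩

/-- **`2q ≤ dim R`**: the quadratic equations read `2q` distinct free variables (read-once).
[cite: LiYang2022, Prop. 2.4] -/
theorem two_mul_quadCount_le_dim : 2 * R.quadCount ≤ R.dim := by
  set Q := univ.filter fun l => (R.quad l).isSome with hQ
  have hbi : (Q.biUnion R.quadVars).card = ∑ l ∈ Q, (R.quadVars l).card :=
    card_biUnion fun l _ l' _ hll => disjoint_quadVars hll
  have hsum : ∑ l ∈ Q, (R.quadVars l).card = ∑ l ∈ Q, 2 := by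
    refine sum_congr rfl fun l hl => ?_
    rw [hQ, mem_filter] at hl
    obtain ⟨e, he⟩ := Option.isSome_iff_exists.mp hl.2
    exact card_quadVars he
  have hsub : Q.biUnion R.quadVars ⊆ univ.filter fun j => R.Free j :=
    biUnion_subset.mpr fun l _ => quadVars_subset l
  have := card_le_card hsub
  rw [hbi, hsum, sum_const, smul_eq_mul] at this
  unfold quadCount dim
  rw [← hQ]
  linarith

/-- **Proposition 2.4 of Li–Yang** (ECCC TR21-023 Prop. 2.3): an rdq-source of dimension `D` with
`q` quadratic equations contains a nonempty affine subspace of dimension at least `D - q ≥ D/2`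
(so a source of dimension `2d` contains an affine subspace of dimension `d`).
[cite: LiYang2022, Prop. 2.4] -/
theorem exists_affineSubspace_subset_sol (R : RdqSource n) :
    ∃ A : AffineSubspace (ZMod 2) (Fin n → ZMod 2), (A : Set (Fin n → ZMod 2)) ⊆ R.Sol ∧
      (A : Set (Fin n → ZMod 2)).Nonempty ∧
      R.dim ≤ finrank (ZMod 2) A.direction + R.quadCount ∧ 2 * R.quadCount ≤ R.dim :=
  ⟨R.canSubspace, canSubspace_subset_sol, canSubspace_nonempty,
    finrank_canSubspace (R := R) ▸ dim_le_card_kept_add_quadCount, two_mul_quadCount_le_dim⟩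

end RdqSource

/-! ### Affine dispersers on rdq-sources -/

/-- **An affine disperser is not constant on an rdq-source of dimension `≥ 2d`** (Li–Yang
Prop. 2.4, second sentence). [cite: LiYang2022, Prop. 2.4] -/
theorem IsAffineDisperser.exists_ne_of_sol {n d : ℕ} {f : (Fin n → ZMod 2) → Bool}
    (hf : IsAffineDisperser f d) (R : RdqSource n) (hd : 2 * d ≤ R.dim) :
    ∃ u ∈ R.Sol, ∃ v ∈ R.Sol, f u ≠ f v := by
  obtain ⟨A, hA, hne, hdim, hq⟩ := R.exists_affineSubspace_subset_sol
  obtain ⟨u, hu, v, hv, huv⟩ := hf A (by omega) hne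
  exact ⟨u, hA hu, v, hA hv, huv⟩

/-- On an rdq-source of dimension `≥ 2d + 2`, an affine disperser for dimension `d` is not a
function of a single coordinate: there are two solutions agreeing at `x_j` with different values.
(Used to rule out circuits whose output node is a variable.) [cite: LiYang2022, Prop. 2.4] -/
theorem IsAffineDisperser.exists_ne_of_sol_coord {n d : ℕ} {f : (Fin n → ZMod 2) → Bool}
    (hf : IsAffineDisperser f d) (R : RdqSource n) (hd : 2 * d + 2 ≤ R.dim) (j : Fin n) :
    ∃ u ∈ R.Sol, ∃ v ∈ R.Sol, u j = v j ∧ f u ≠ f v := by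
  obtain ⟨A, hA, hne, hdim, hq⟩ := R.exists_affineSubspace_subset_sol
  obtain ⟨A', hA', hne', hdim', hconst⟩ := exists_le_coord_const A hne j
  obtain ⟨u, hu, v, hv, huv⟩ := hf A' (by omega) hne'
  exact ⟨u, hA (hA' hu), v, hA (hA' hv), hconst u hu v hv, huv⟩

namespace Semicircuit

variable {n : ℕ} (C : Semicircuit n)

/-- **The output of a semicircuit computing a disperser is a gate.** If a fair semicircuit
computes `f|_R` for an affine disperser `f` for dimension `d` and `dim R ≥ 2d + 2`, then its
output node is neither a constant nor a variable (Li–Yang §4.1, proof of Thm. 4.1: "the function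
is not trivial after performing these substitutions, so the output gate of the circuit will not be
trivialized"). [cite: LiYang2022, proof of Thm. 4.1 (§4.1)] -/
theorem exists_out_eq_gate {d : ℕ} {f : (Fin n → ZMod 2) → Bool} (hf : IsAffineDisperser f d)
    {R : RdqSource n} (hF : C.Fair) (hC : C.ComputesRestr f R) (hd : 2 * d + 2 ≤ R.dim) :
    ∃ k, C.out = .gate k := by
  cases hout : C.out with
  | gate k => exact ⟨k, rfl⟩
  | const b =>
    exfalso
    obtain ⟨u, hu, v, hv, huv⟩ := hf.exists_ne_of_sol R (by omega)
    obtain ⟨wu, hwu, -⟩ := hF (boolOfZMod2.symm u)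
    obtain ⟨wv, hwv, -⟩ := hF (boolOfZMod2.symm v)
    have h1 := hC.2 u hu wu hwu
    have h2 := hC.2 v hv wv hwv
    rw [hout] at h1 h2
    exact huv (h1.symm.trans h2)
  | var j =>
    exfalso
    obtain ⟨u, hu, v, hv, hj, huv⟩ := hf.exists_ne_of_sol_coord R hd j
    obtain ⟨wu, hwu, -⟩ := hF (boolOfZMod2.symm u)
    obtain ⟨wv, hwv, -⟩ := hF (boolOfZMod2.symm v)
    have h1 := hC.2 u hu wu hwu
    have h2 := hC.2 v hv wv hwv
    rw [hout] at h1 h2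
    change boolOfZMod2.symm u j = f u at h1
    change boolOfZMod2.symm v j = f v at h2
    rw [Circuit.boolOfZMod2_symm_apply, hj] at h1
    rw [Circuit.boolOfZMod2_symm_apply] at h2
    exact huv (h1.symm.trans h2)

end Semicircuit


/-! ### Affine and quadratic expressions over `𝔽₂` -/

/-- In characteristic two, the sum over a symmetric difference is the sum of the sums. [folklore] -/
theorem sum_symmDiff_zmod2 {α : Type*} [DecidableEq α] (A B : Finset α) (v : α → ZMod 2) :
    ∑ i ∈ symmDiff A B, v i = ∑ i ∈ A, v i + ∑ i ∈ B, v i := by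
  have h2 : ∀ a : ZMod 2, a + a = 0 := by decide
  have hA := sum_sdiff (f := v) (inter_subset_left (s₁ := A) (s₂ := B))
  have hB := sum_sdiff (f := v) (inter_subset_right (s₁ := A) (s₂ := B))
  have hAB : A \ (A ∩ B) = A \ B := by
    ext i; simp only [mem_sdiff, mem_inter, not_and]; tauto
  have hBA : B \ (A ∩ B) = B \ A := by
    ext i; simp only [mem_sdiff, mem_inter, not_and']; tauto
  rw [hAB] at hA
  rw [hBA] at hB
  have hdis : Disjoint (A \ B) (B \ A) := disjoint_sdiff_sdiff
  rw [symmDiff_def, sup_eq_union, sum_union hdis, ← hA, ← hB]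
  have := h2 (∑ x ∈ A ∩ B, v x)
  linear_combination (-1 : ZMod 2) * this

namespace LinEq

variable {n : ℕ}

/-- The value `c + Σ_{i ∈ support} v_i` of the right-hand side of an affine equation at `v`.
[cite: LiYang2022, Def. 2.2] -/
def eval (E : LinEq n) (v : Fin n → ZMod 2) : ZMod 2 := E.c + ∑ i ∈ E.support, v i

/-- Unfolding `x_l := E'` (an affine expression not involving `x_l`) in the affine expression `E`:
if `x_l` occurs, it is replaced by `E'` (supports combine by symmetric difference over `𝔽₂`).
Used for substitutions in rdq-sources (Li–Yang §2.4: "all its occurrences in linear and quadratic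
equations are replaced"). [cite: LiYang2022, §2.4] -/
def substVar (E : LinEq n) (l : Fin n) (E' : LinEq n) : LinEq n :=
  if l ∈ E.support then ⟨symmDiff (E.support.erase l) E'.support, E.c + E'.c⟩ else E

/-- Unfolding does not change the value when `x_l = E'(v)`. [folklore] -/
theorem eval_substVar (E E' : LinEq n) {l : Fin n} {v : Fin n → ZMod 2} (hv : v l = E'.eval v) :
    (E.substVar l E').eval v = E.eval v := by
  unfold substVar
  split_ifs with h
  · unfold eval at hv ⊢
    simp only
    rw [sum_symmDiff_zmod2, ← sum_erase_add _ _ h, hv]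
    ring
  · rfl

/-- The support after unfolding. [folklore] -/
theorem mem_support_substVar {E E' : LinEq n} {l i : Fin n} (hi : i ∈ (E.substVar l E').support) :
    (i ∈ E.support ∧ i ≠ l) ∨ i ∈ E'.support := by
  unfold substVar at hi
  split_ifs at hi with h
  · simp only at hi
    rw [mem_symmDiff, mem_erase] at hi
    tauto
  · exact Or.inl ⟨hi, fun hil => h (hil ▸ hi)⟩

/-- After unfolding `x_l := E'` with `x_l ∉ E'`, `x_l` no longer occurs. [folklore] -/
theorem not_mem_support_substVar (E : LinEq n) {E' : LinEq n} {l : Fin n} (hl : l ∉ E'.support) :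
    l ∉ (E.substVar l E').support := fun h => by
  rcases mem_support_substVar h with ⟨-, h⟩ | h
  · exact h rfl
  · exact hl h

/-- The constant affine expression `b`. [folklore] -/
def const (b : ZMod 2) : LinEq n := ⟨∅, b⟩

/-- The constant expression evaluates to its constant. [folklore] -/
@[simp] theorem eval_const (b : ZMod 2) (v : Fin n → ZMod 2) : (const b : LinEq n).eval v = b := by
  simp [eval, const]

/-- The constant expression has empty support. [folklore] -/
@[simp] theorem support_const (b : ZMod 2) : (const b : LinEq n).support = ∅ := rfl

end LinEq

namespace QuadEq

variable {n : ℕ}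

/-- The value `((v_i + c₁)(v_k + c₂)) + c₃` of the right-hand side of a quadratic equation.
[cite: LiYang2022, Def. 2.2] -/
def eval (e : QuadEq n) (v : Fin n → ZMod 2) : ZMod 2 := (v e.i + e.c₁) * (v e.k + e.c₂) + e.c₃

/-- The quadratic equation reads the variable `x_j`. [cite: LiYang2022, Def. 2.2] -/
def Reads (e : QuadEq n) (j : Fin n) : Prop := e.i = j ∨ e.k = j

/-- Reading a variable is decidable. [folklore] -/
instance (e : QuadEq n) (j : Fin n) : Decidable (e.Reads j) := by unfold Reads; infer_instance

/-- The other variable read (the *couple* of `x_j`, Li–Yang §2.3). [cite: LiYang2022, §2.3] -/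
def other (e : QuadEq n) (j : Fin n) : Fin n := if e.i = j then e.k else e.i

/-- The shift of `x_j` in the equation. [folklore] -/
def shiftOf (e : QuadEq n) (j : Fin n) : ZMod 2 := if e.i = j then e.c₁ else e.c₂

/-- The shift of the couple of `x_j` in the equation. [folklore] -/
def otherShift (e : QuadEq n) (j : Fin n) : ZMod 2 := if e.i = j then e.c₂ else e.c₁

/-- **Linearization** of a quadratic equation under `x_j := b`: the right-hand side
`((x_j + s)(x_o + s') ) + c₃` becomes the affine expression `(b + s) x_o + (b + s) s' + c₃`
(Li–Yang §2.4: "the quadratic equation for `x_i` becomes an affine equation, hence `x_i`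
becomes a linear variable"). [cite: LiYang2022, §2.4] -/
def linearize (e : QuadEq n) (j : Fin n) (b : ZMod 2) : LinEq n :=
  ⟨if b + e.shiftOf j = 0 then ∅ else {e.other j}, (b + e.shiftOf j) * e.otherShift j + e.c₃⟩

/-- The support of the linearization is at most the couple. [folklore] -/
theorem support_linearize_subset (e : QuadEq n) (j : Fin n) (b : ZMod 2) :
    (e.linearize j b).support ⊆ {e.other j} := by
  unfold linearize
  split_ifs <;> simp

/-- The couple of `x_j` is distinct from `x_j` (for an equation of a source, reading `x_j`). [folklore] -/
theorem other_ne (e : QuadEq n) {j : Fin n} (hr : e.Reads j) (hik : e.i ≠ e.k) : e.other j ≠ j := by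
  unfold other
  split_ifs with h
  · exact fun hk => hik (h.trans hk.symm)
  · rcases hr with h' | h'
    · exact absurd h' h
    · exact fun hi => hik (hi.trans h'.symm)

/-- The couple is one of the two variables read. [folklore] -/
theorem other_mem (e : QuadEq n) (j : Fin n) : e.other j = e.i ∨ e.other j = e.k := by
  unfold other
  split_ifs
  · exact Or.inr rfl
  · exact Or.inl rfl

/-- **The linearization agrees with the quadratic expression when `x_j = b`.** [cite: LiYang2022, §2.4] -/
theorem eval_linearize (e : QuadEq n) {j : Fin n} (hr : e.Reads j) {b : ZMod 2} {v : Fin n → ZMod 2}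
    (hv : v j = b) : (e.linearize j b).eval v = e.eval v := by
  have h01 : ∀ a : ZMod 2, a ≠ 0 → a = 1 := by decide
  unfold linearize LinEq.eval eval other shiftOf otherShift
  by_cases hij : e.i = j
  · subst hij
    simp only [if_true]
    rw [hv]
    by_cases h0 : b + e.c₁ = 0
    · rw [if_pos h0, h0]; simp
    · rw [if_neg h0, h01 _ h0]; simp; ring
  · have hkj : e.k = j := hr.resolve_left hij
    subst hkj
    simp only [hij, if_false]
    rw [hv]
    by_cases h0 : b + e.c₂ = 0
    · rw [if_pos h0, h0]; simp
    · rw [if_neg h0, h01 _ h0]; simp; ring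

end QuadEq

namespace RdqSource

variable {n : ℕ} (R : RdqSource n)

/-! ### Basic API of rdq-sources -/

variable {R} in
/-- Membership in the solution set, with `LinEq.eval` / `QuadEq.eval`. [cite: LiYang2022, §2.3] -/
theorem mem_sol_iff {v : Fin n → ZMod 2} :
    v ∈ R.Sol ↔ (∀ j E, R.lin j = some E → v j = E.eval v) ∧ ∀ j e, R.quad j = some e → v j = e.eval v :=
  Iff.rfl

variable {R} in
/-- A linear variable is not free. [folklore] -/
theorem not_free_of_lin {j : Fin n} {E : LinEq n} (h : R.lin j = some E) : ¬ R.Free j := fun hf => by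
  rw [hf.1] at h; exact Option.some_ne_none _ h.symm

variable {R} in
/-- A quadratic variable is not free. [folklore] -/
theorem not_free_of_quad {j : Fin n} {e : QuadEq n} (h : R.quad j = some e) : ¬ R.Free j := fun hf => by
  rw [hf.2] at h; exact Option.some_ne_none _ h.symm

variable {R} in
/-- A quadratic variable has no affine equation. [folklore] -/
theorem lin_eq_none_of_quad {j : Fin n} {e : QuadEq n} (h : R.quad j = some e) : R.lin j = none := by
  rcases R.lin_or_quad j with h' | h'
  · exact h'
  · rw [h] at h'; exact absurd h' (Option.some_ne_none _)

variable {R} in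
/-- The variables read by a quadratic equation are free. [folklore] -/
theorem free_of_reads {l : Fin n} {e : QuadEq n} (h : R.quad l = some e) {j : Fin n} (hr : e.Reads j) :
    R.Free j := by
  rcases hr with rfl | rfl
  · exact (R.quad_wf l e h).1
  · exact (R.quad_wf l e h).2.1

variable {R} in
/-- The couple of a variable read by a quadratic equation is free. [folklore] -/
theorem free_other {l : Fin n} {e : QuadEq n} (h : R.quad l = some e) (j : Fin n) : R.Free (e.other j) := by
  rcases e.other_mem j with h' | h'
  · rw [h']; exact (R.quad_wf l e h).1
  · rw [h']; exact (R.quad_wf l e h).2.1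

variable {R} in
/-- A variable read by a quadratic equation is protected. [cite: LiYang2022, §2.3] -/
theorem protected_of_reads {l : Fin n} {e : QuadEq n} (h : R.quad l = some e) {j : Fin n} (hr : e.Reads j) :
    R.Protected j :=
  ⟨free_of_reads h hr, l, e, h, hr⟩

variable {R} in
/-- Read-once: the quadratic equation reading a given variable is unique. [folklore] -/
theorem quad_unique_of_reads {l l' : Fin n} {e e' : QuadEq n} (h : R.quad l = some e)
    (h' : R.quad l' = some e') {j : Fin n} (hr : e.Reads j) (hr' : e'.Reads j) : l = l' ∧ e = e' := by
  by_cases hll : l = l'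
  · subst hll
    rw [h] at h'
    exact ⟨rfl, Option.some.inj h'⟩
  · have hro := R.read_once l l' e e' h h' hll
    exfalso
    rcases hr with rfl | rfl <;> rcases hr' with h1 | h1
    · exact hro.1 h1.symm
    · exact hro.2.1 h1.symm
    · exact hro.2.2.1 h1.symm
    · exact hro.2.2.2 h1.symm

/-! ### Making a quadratic variable linear (`setLin`) -/

/-- Replace the quadratic equation of the quadratic variable `x_l` by the affine equation
`x_l = E'` (with `E'` supported on free variables) and unfold `x_l := E'` in every affine equation.
This is the source-side effect of a substitution on a protected variable (Li–Yang §2.4: the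
quadratic equation "becomes an affine equation, hence `x_i` becomes a linear variable").
[cite: LiYang2022, §2.4] -/
def setLin (l : Fin n) (E' : LinEq n) (hl : (R.quad l).isSome = true) (hE : ∀ i ∈ E'.support, R.Free i) :
    RdqSource n where
  lin i := if i = l then some E' else (R.lin i).map fun E => E.substVar l E'
  quad i := if i = l then none else R.quad i
  lin_or_quad i := by
    by_cases h : i = l
    · exact Or.inr (by simp [h])
    · rcases R.lin_or_quad i with h' | h'
      · exact Or.inl (by simp [h, h'])
      · exact Or.inr (by simp [h, h'])
  lin_wf i E h i' hi' := by
    obtain ⟨e, he⟩ := Option.isSome_iff_exists.mp hl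
    have hfree_ne : ∀ i'', R.Free i'' → i'' ≠ l := fun i'' hf h => not_free_of_quad he (h ▸ hf)
    by_cases hi : i = l
    · subst hi
      simp only [if_true, Option.some.injEq] at h
      subst h
      have hf := hE i' hi'
      simp [hfree_ne i' hf, hf.1]
    · simp only [hi, if_false] at h
      obtain ⟨E₀, hE₀, rfl⟩ := Option.map_eq_some_iff.mp h
      rcases LinEq.mem_support_substVar hi' with ⟨hmem, hne⟩ | hmem
      · simp [hne, R.lin_wf i E₀ hE₀ i' hmem]
      · have hf := hE i' hmem
        simp [hfree_ne i' hf, hf.1]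
  quad_wf i e h := by
    by_cases hi : i = l
    · simp [hi] at h
    · simp only [hi, if_false] at h
      obtain ⟨e₀, he₀⟩ := Option.isSome_iff_exists.mp hl
      have hw := R.quad_wf i e h
      have hil : e.i ≠ l := fun h' => not_free_of_quad he₀ (h' ▸ hw.1)
      have hkl : e.k ≠ l := fun h' => not_free_of_quad he₀ (h' ▸ hw.2.1)
      simp [hil, hkl, hw.1.1, hw.1.2, hw.2.1.1, hw.2.1.2, hw.2.2]
  read_once i i' e e' h h' hii' := by
    by_cases hi : i = l
    · simp [hi] at h
    by_cases hi' : i' = l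
    · simp [hi'] at h'
    simp only [hi, hi', if_false] at h h'
    exact R.read_once i i' e e' h h' hii'

section SetLin

variable {R}
variable {l : Fin n} {E' : LinEq n} (hl : (R.quad l).isSome = true) (hE : ∀ i ∈ E'.support, R.Free i)

/-- Affine equations after `setLin`. [folklore] -/
theorem setLin_lin (i : Fin n) :
    (R.setLin l E' hl hE).lin i = if i = l then some E' else (R.lin i).map fun E => E.substVar l E' := rfl

/-- Quadratic equations after `setLin`. [folklore] -/
theorem setLin_quad (i : Fin n) :
    (R.setLin l E' hl hE).quad i = if i = l then none else R.quad i := rfl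

/-- `setLin` does not change the free variables. [folklore] -/
theorem free_setLin_iff (i : Fin n) : (R.setLin l E' hl hE).Free i ↔ R.Free i := by
  obtain ⟨e, he⟩ := Option.isSome_iff_exists.mp hl
  unfold Free
  rw [setLin_lin, setLin_quad]
  by_cases hi : i = l
  · subst hi
    simp [he]
  · simp [hi]

/-- `setLin` does not change the dimension. [cite: LiYang2022, §2.4] -/
theorem dim_setLin : (R.setLin l E' hl hE).dim = R.dim := by
  unfold dim
  congr 1
  exact filter_congr fun i _ => free_setLin_iff hl hE i

/-- `setLin` removes one quadratic equation. [cite: LiYang2022, §2.4] -/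
theorem quadCount_setLin : (R.setLin l E' hl hE).quadCount + 1 = R.quadCount := by
  unfold quadCount
  have h1 : (univ.filter fun j => ((R.setLin l E' hl hE).quad j).isSome) =
      (univ.filter fun j => (R.quad j).isSome).erase l := by
    ext j
    simp only [setLin_quad, mem_filter, mem_univ, true_and, mem_erase]
    by_cases hj : j = l
    · simp [hj]
    · simp [hj]
  rw [h1, card_erase_add_one]
  simpa using hl

/-- Protected variables after `setLin`: those of the remaining quadratic equations. [folklore] -/
theorem protected_setLin_iff (i : Fin n) :
    (R.setLin l E' hl hE).Protected i ↔
      R.Free i ∧ ∃ (l' : Fin n) (e : QuadEq n), l' ≠ l ∧ R.quad l' = some e ∧ e.Reads i := by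
  unfold Protected
  rw [free_setLin_iff]
  simp only [setLin_quad]
  constructor
  · rintro ⟨hf, l', e, h, hr⟩
    by_cases hl' : l' = l
    · simp [hl'] at h
    · simp only [hl', if_false] at h
      exact ⟨hf, l', e, hl', h, hr⟩
  · rintro ⟨hf, l', e, hl', h, hr⟩
    exact ⟨hf, l', e, by simp [hl', h], hr⟩

/-- A variable protected after `setLin` was protected before. [folklore] -/
theorem protected_of_protected_setLin {i : Fin n} (h : (R.setLin l E' hl hE).Protected i) :
    R.Protected i := by
  obtain ⟨hf, l', e, -, h, hr⟩ := (protected_setLin_iff hl hE i).mp h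
  exact ⟨hf, l', e, h, hr⟩

/-- The variables of the removed quadratic equation are no longer protected. [folklore] -/
theorem not_protected_setLin_of_reads {e : QuadEq n} (he : R.quad l = some e) {j : Fin n}
    (hr : e.Reads j) : ¬ (R.setLin l E' hl hE).Protected j := by
  intro h
  obtain ⟨-, l', e', hl', h', hr'⟩ := (protected_setLin_iff hl hE j).mp h
  exact hl' (quad_unique_of_reads h' he hr' hr).1

/-- **Solutions after `setLin`**: `x_l = E'`, the other quadratic equations, and the old affine
equations. [cite: LiYang2022, §2.4] -/
theorem mem_sol_setLin_iff (v : Fin n → ZMod 2) :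
    v ∈ (R.setLin l E' hl hE).Sol ↔ v l = E'.eval v ∧ (∀ j E, R.lin j = some E → v j = E.eval v) ∧
      ∀ j e, j ≠ l → R.quad j = some e → v j = e.eval v := by
  obtain ⟨e₀, he₀⟩ := Option.isSome_iff_exists.mp hl
  rw [mem_sol_iff]
  simp only [setLin_lin, setLin_quad]
  constructor
  · rintro ⟨hlin, hquad⟩
    have hvl : v l = E'.eval v := hlin l E' (by simp)
    refine ⟨hvl, fun j E hj => ?_, fun j e hjl hj => hquad j e (by simp [hjl, hj])⟩
    have hjl : j ≠ l := fun h => by rw [h, lin_eq_none_of_quad he₀] at hj; exact Option.some_ne_none _ hj.symm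
    have := hlin j (E.substVar l E') (by simp [hjl, hj])
    rwa [LinEq.eval_substVar _ _ hvl] at this
  · rintro ⟨hvl, hlin, hquad⟩
    refine ⟨fun j E hj => ?_, fun j e hj => ?_⟩
    · by_cases hjl : j = l
      · subst hjl
        simp only [if_true, Option.some.injEq] at hj
        rw [← hj]; exact hvl
      · simp only [hjl, if_false] at hj
        obtain ⟨E₀, hE₀, rfl⟩ := Option.map_eq_some_iff.mp hj
        rw [LinEq.eval_substVar _ _ hvl]
        exact hlin j E₀ hE₀
    · by_cases hjl : j = l
      · simp [hjl] at hj
      · simp only [hjl, if_false] at hj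
        exact hquad j e hjl hj

end SetLin

/-! ### Assigning a constant to an unprotected free variable (`assignFree`) -/

/-- The rdq-source after the constant substitution `x_j := b` to an **unprotected** free
variable: `x_j` becomes linear with the equation `x_j = b`, and its occurrences in affine
equations are replaced by `b` (Li–Yang §2.4, "Constant substitution"). [cite: LiYang2022, §2.4] -/
def assignFree (j : Fin n) (b : ZMod 2) (hj : R.Free j) (hjp : ¬ R.Protected j) : RdqSource n where
  lin i := if i = j then some (LinEq.const b) else (R.lin i).map fun E => E.substVar j (LinEq.const b)
  quad := R.quad
  lin_or_quad i := by
    by_cases h : i = j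
    · exact Or.inr (h ▸ hj.2)
    · rcases R.lin_or_quad i with h' | h'
      · exact Or.inl (by simp [h, h'])
      · exact Or.inr h'
  lin_wf i E h i' hi' := by
    by_cases hi : i = j
    · subst hi
      simp only [if_true, Option.some.injEq] at h
      subst h
      simp at hi'
    · simp only [hi, if_false] at h
      obtain ⟨E₀, hE₀, rfl⟩ := Option.map_eq_some_iff.mp h
      rcases LinEq.mem_support_substVar hi' with ⟨hmem, hne⟩ | hmem
      · simp [hne, R.lin_wf i E₀ hE₀ i' hmem]
      · simp at hmem
  quad_wf i e h := by
    have hw := R.quad_wf i e h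
    have hij : e.i ≠ j := fun h' => hjp (protected_of_reads h (Or.inl h'))
    have hkj : e.k ≠ j := fun h' => hjp (protected_of_reads h (Or.inr h'))
    simp [hij, hkj, hw.1.1, hw.1.2, hw.2.1.1, hw.2.1.2, hw.2.2]
  read_once := R.read_once

section AssignFree

variable {R}
variable {j : Fin n} {b : ZMod 2} (hj : R.Free j) (hjp : ¬ R.Protected j)

/-- Affine equations after `assignFree`. [folklore] -/
theorem assignFree_lin (i : Fin n) :
    (R.assignFree j b hj hjp).lin i =
      if i = j then some (LinEq.const b) else (R.lin i).map fun E => E.substVar j (LinEq.const b) := rfl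

/-- Quadratic equations are unchanged by `assignFree`. [folklore] -/
@[simp] theorem assignFree_quad : (R.assignFree j b hj hjp).quad = R.quad := rfl

/-- Free variables after `assignFree`: all but `x_j`. [cite: LiYang2022, §2.4] -/
theorem free_assignFree_iff (i : Fin n) : (R.assignFree j b hj hjp).Free i ↔ R.Free i ∧ i ≠ j := by
  unfold Free
  rw [assignFree_lin, assignFree_quad]
  by_cases hi : i = j
  · subst hi; simp
  · simp [hi]

/-- **`assignFree` lowers the dimension by one.** [cite: LiYang2022, §2.4] -/
theorem dim_assignFree : (R.assignFree j b hj hjp).dim + 1 = R.dim := by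
  unfold dim
  have h1 : (univ.filter fun i => (R.assignFree j b hj hjp).Free i) = (univ.filter fun i => R.Free i).erase j := by
    ext i
    simp only [mem_filter, mem_univ, true_and, mem_erase, free_assignFree_iff]
    tauto
  rw [h1, card_erase_add_one]
  simpa using hj

/-- `assignFree` keeps the number of quadratic equations. [folklore] -/
@[simp] theorem quadCount_assignFree : (R.assignFree j b hj hjp).quadCount = R.quadCount := rfl

/-- `assignFree` keeps the protected variables. [folklore] -/
theorem protected_assignFree_iff (i : Fin n) : (R.assignFree j b hj hjp).Protected i ↔ R.Protected i := by
  unfold Protected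
  rw [free_assignFree_iff, assignFree_quad]
  constructor
  · rintro ⟨⟨hf, -⟩, h⟩; exact ⟨hf, h⟩
  · rintro ⟨hf, l, e, h, hr⟩
    exact ⟨⟨hf, fun hij => hjp (hij ▸ ⟨hf, l, e, h, hr⟩)⟩, l, e, h, hr⟩

/-- **Solutions after `assignFree`**: the old solutions with `x_j = b`. [cite: LiYang2022, Prop. 2.6] -/
theorem mem_sol_assignFree_iff (v : Fin n → ZMod 2) :
    v ∈ (R.assignFree j b hj hjp).Sol ↔ v ∈ R.Sol ∧ v j = b := by
  rw [mem_sol_iff, mem_sol_iff]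
  simp only [assignFree_lin, assignFree_quad]
  constructor
  · rintro ⟨hlin, hquad⟩
    have hvj : v j = b := by simpa using hlin j (LinEq.const b) (by simp)
    have hvj' : v j = (LinEq.const b : LinEq n).eval v := by simp [hvj]
    refine ⟨⟨fun i E hi => ?_, hquad⟩, hvj⟩
    have hij : i ≠ j := fun h => by rw [h, hj.1] at hi; exact Option.some_ne_none _ hi.symm
    have := hlin i (E.substVar j (LinEq.const b)) (by simp [hij, hi])
    rwa [LinEq.eval_substVar _ _ hvj'] at this
  · rintro ⟨⟨hlin, hquad⟩, hvj⟩
    have hvj' : v j = (LinEq.const b : LinEq n).eval v := by simp [hvj]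
    refine ⟨fun i E hi => ?_, hquad⟩
    by_cases hij : i = j
    · subst hij
      simp only [if_true, Option.some.injEq] at hi
      rw [← hi]; simp [hvj]
    · simp only [hij, if_false] at hi
      obtain ⟨E₀, hE₀, rfl⟩ := Option.map_eq_some_iff.mp hi
      rw [LinEq.eval_substVar _ _ hvj']
      exact hlin i E₀ hE₀

/-- Solutions after `assignFree`, as a set. [cite: LiYang2022, Prop. 2.6] -/
theorem sol_assignFree : (R.assignFree j b hj hjp).Sol = R.Sol ∩ {v | v j = b} :=
  Set.ext fun v => mem_sol_assignFree_iff hj hjp v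

end AssignFree

/-! ### Assigning a constant to a protected variable (`assignProtected`) -/

section AssignProtected

variable {R}

/-- The intermediate source: the quadratic equation `e` of `x_l` linearized at `x_j = b`. [folklore] -/
abbrev linearizeAt {l : Fin n} {e : QuadEq n} (he : R.quad l = some e) (j : Fin n) (b : ZMod 2) :
    RdqSource n :=
  R.setLin l (e.linearize j b) (by rw [he]; rfl) fun i hi => by
    have := e.support_linearize_subset j b hi
    rw [mem_singleton] at this
    rw [this]
    exact free_other he j

/-- After linearizing its quadratic equation, `x_j` is free. [folklore] -/
theorem free_linearizeAt {l : Fin n} {e : QuadEq n} (he : R.quad l = some e) {j : Fin n}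
    (hr : e.Reads j) (b : ZMod 2) : (linearizeAt he j b).Free j :=
  (free_setLin_iff _ _ j).mpr (free_of_reads he hr)

/-- After linearizing its quadratic equation, `x_j` is unprotected (read-once). [folklore] -/
theorem not_protected_linearizeAt {l : Fin n} {e : QuadEq n} (he : R.quad l = some e) {j : Fin n}
    (hr : e.Reads j) (b : ZMod 2) : ¬ (linearizeAt he j b).Protected j :=
  not_protected_setLin_of_reads _ _ he hr

/-- The rdq-source after the constant substitution `x_j := b` to a **protected** free variable
`x_j`, read by the quadratic equation `e` of `x_l`: that equation becomes the affine equation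
`x_l = (b + s) x_o + …` (so `x_l` becomes linear and the couple `x_o` unprotected), `x_j` becomes
linear with `x_j = b`, and all occurrences are unfolded (Li–Yang §2.4, "Constant substitution":
"all its occurrence in linear and quadratic equations are replaced by the constant").
[cite: LiYang2022, §2.4] -/
def assignProtected {l : Fin n} {e : QuadEq n} (he : R.quad l = some e) {j : Fin n} (hr : e.Reads j)
    (b : ZMod 2) : RdqSource n :=
  (linearizeAt he j b).assignFree j b (free_linearizeAt he hr b) (not_protected_linearizeAt he hr b)

variable {j l : Fin n} {e : QuadEq n} (he : R.quad l = some e) (hr : e.Reads j) (b : ZMod 2)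

/-- Free variables after `assignProtected`: all but `x_j`. [cite: LiYang2022, §2.4] -/
theorem free_assignProtected_iff (i : Fin n) : (assignProtected he hr b).Free i ↔ R.Free i ∧ i ≠ j := by
  unfold assignProtected
  rw [free_assignFree_iff, free_setLin_iff]

/-- **`assignProtected` lowers the dimension by one.** [cite: LiYang2022, §2.4] -/
theorem dim_assignProtected : (assignProtected he hr b).dim + 1 = R.dim := by
  unfold assignProtected
  rw [dim_assignFree, dim_setLin]

/-- **`assignProtected` kills one quadratic equation.** [cite: LiYang2022, §2.4] -/
theorem quadCount_assignProtected : (assignProtected he hr b).quadCount + 1 = R.quadCount := by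
  unfold assignProtected
  rw [quadCount_assignFree, quadCount_setLin]

/-- Protected variables after `assignProtected`: those of the other quadratic equations; in
particular neither `x_j` nor its couple. [folklore] -/
theorem protected_assignProtected_iff (i : Fin n) :
    (assignProtected he hr b).Protected i ↔
      R.Free i ∧ ∃ (l' : Fin n) (e' : QuadEq n), l' ≠ l ∧ R.quad l' = some e' ∧ e'.Reads i := by
  unfold assignProtected
  rw [protected_assignFree_iff, protected_setLin_iff]

/-- A variable protected after `assignProtected` was protected before. [folklore] -/
theorem protected_of_protected_assignProtected {i : Fin n}
    (h : (assignProtected he hr b).Protected i) : R.Protected i := by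
  obtain ⟨hf, l', e', -, h', hr'⟩ := (protected_assignProtected_iff he hr b i).mp h
  exact ⟨hf, l', e', h', hr'⟩

/-- The variables of the killed quadratic equation (`x_j` and its couple) are no longer
protected. [folklore] -/
theorem not_protected_assignProtected_of_reads {i : Fin n} (hi : e.Reads i) :
    ¬ (assignProtected he hr b).Protected i := by
  intro h
  obtain ⟨-, l', e', hl', h', hr'⟩ := (protected_assignProtected_iff he hr b i).mp h
  exact hl' (quad_unique_of_reads h' he hr' hi).1

/-- **Solutions after `assignProtected`**: the old solutions with `x_j = b`. [cite: LiYang2022, Prop. 2.6] -/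
theorem mem_sol_assignProtected_iff (v : Fin n → ZMod 2) :
    v ∈ (assignProtected he hr b).Sol ↔ v ∈ R.Sol ∧ v j = b := by
  unfold assignProtected
  rw [mem_sol_assignFree_iff, mem_sol_setLin_iff, mem_sol_iff]
  constructor
  · rintro ⟨⟨hvl, hlin, hquad⟩, hvj⟩
    refine ⟨⟨hlin, fun i e' hi => ?_⟩, hvj⟩
    by_cases hil : i = l
    · subst hil
      rw [he] at hi
      obtain rfl := Option.some.inj hi
      rw [hvl, QuadEq.eval_linearize _ hr hvj]
    · exact hquad i e' hil hi
  · rintro ⟨⟨hlin, hquad⟩, hvj⟩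
    refine ⟨⟨?_, hlin, fun i e' _ hi => hquad i e' hi⟩, hvj⟩
    rw [QuadEq.eval_linearize _ hr hvj]
    exact hquad l e he

/-- Solutions after `assignProtected`, as a set. [cite: LiYang2022, Prop. 2.6] -/
theorem sol_assignProtected : (assignProtected he hr b).Sol = R.Sol ∩ {v | v j = b} :=
  Set.ext fun v => mem_sol_assignProtected_iff he hr b v

end AssignProtected

end RdqSource


/-! ### Constant substitution in a semicircuit (Li–Yang §2.4) -/

namespace Node

variable {n m : ℕ}

/-- Replace the variable node `x_j` by the constant node `b`. [cite: LiYang2022, §2.4] -/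
def substConst (j : Fin n) (b : Bool) : Node n m → Node n m
  | .var i => if i = j then .const b else .var i
  | v => v

/-- Substitution on a constant node. [folklore] -/
@[simp] theorem substConst_const (j : Fin n) (b b' : Bool) :
    (Node.const b' : Node n m).substConst j b = .const b' := rfl

/-- Substitution on a gate node. [folklore] -/
@[simp] theorem substConst_gate (j : Fin n) (b : Bool) (k : Fin m) :
    (Node.gate k : Node n m).substConst j b = .gate k := rfl

/-- Substitution on the substituted variable. [folklore] -/
@[simp] theorem substConst_var_self (j : Fin n) (b : Bool) :
    (Node.var j : Node n m).substConst j b = .const b := by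
  simp [substConst]

/-- Substitution on another variable. [folklore] -/
theorem substConst_var_of_ne {j i : Fin n} (h : i ≠ j) (b : Bool) :
    (Node.var i : Node n m).substConst j b = .var i := by
  simp [substConst, h]

/-- A node other than `x_j` is unchanged. [folklore] -/
theorem substConst_of_ne {j : Fin n} {v : Node n m} (h : v ≠ .var j) (b : Bool) :
    v.substConst j b = v := by
  cases v with
  | const b' => rfl
  | var i => exact substConst_var_of_ne (fun hij => h (by rw [hij])) b
  | gate k => rfl

/-- The result is a gate node iff the node was that gate. [folklore] -/
theorem substConst_eq_gate_iff {j : Fin n} {b : Bool} {v : Node n m} {k : Fin m} :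
    v.substConst j b = .gate k ↔ v = .gate k := by
  cases v with
  | const b' => simp
  | var i => by_cases h : i = j <;> simp [substConst, h]
  | gate k' => simp

/-- The result is a variable node iff the node was that variable and it is not `x_j`. [folklore] -/
theorem substConst_eq_var_iff {j : Fin n} {b : Bool} {v : Node n m} {i : Fin n} :
    v.substConst j b = .var i ↔ v = .var i ∧ i ≠ j := by
  cases v with
  | const b' => simp
  | var i' =>
    by_cases h : i' = j
    · subst h
      simp only [substConst_var_self, reduceCtorEq, Node.var.injEq, false_iff, not_and, not_not]
      exact fun h => h.symm
    · rw [substConst_var_of_ne h]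
      simp only [Node.var.injEq]
      exact ⟨fun h' => ⟨h', fun hij => h (h'.trans hij)⟩, fun h' => h'.1⟩
  | gate k' => simp

/-- The substituted variable no longer occurs. [folklore] -/
theorem substConst_ne_var_self (j : Fin n) (b : Bool) (v : Node n m) : v.substConst j b ≠ .var j :=
  fun h => (substConst_eq_var_iff.mp h).2 rfl

end Node

namespace Semicircuit

variable {n : ℕ} (C : Semicircuit n)

/-- **Constant substitution `x_j := b` in a semicircuit** (Li–Yang §2.4): every wire from the
variable `x_j` (and the output, if it is `x_j`) is rewired to the constant node `b`; gates,
their functions and the xor-part are unchanged (the now trivial/degenerate gates are removed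
later by the normalization rules, §3.3). [cite: LiYang2022, §2.4] -/
abbrev substConst (j : Fin n) (b : Bool) : Semicircuit n where
  m := C.m
  op := C.op
  arg k a := (C.arg k a).substConst j b
  out := C.out.substConst j b
  xorPart := C.xorPart
  isXorOp_of_mem := C.isXorOp_of_mem
  mem_of_arg_eq k hk a k' h := C.mem_of_arg_eq k hk a k' (Node.substConst_eq_gate_iff.mp h)
  acyclic := by
    obtain ⟨ρ, hρ⟩ := C.acyclic
    exact ⟨ρ, fun k hk a k' h hk' => hρ k hk a k' (Node.substConst_eq_gate_iff.mp h) hk'⟩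

section SubstConst

variable (j : Fin n) (b : Bool)

/-- The number of gates is unchanged. [folklore] -/
theorem substConst_m : (C.substConst j b).m = C.m := rfl

/-- The wires after substitution. [folklore] -/
theorem substConst_arg (k : Fin C.m) (a : Fin 2) :
    (C.substConst j b).arg k a = (C.arg k a).substConst j b := rfl

/-- The output after substitution. [folklore] -/
theorem substConst_out : (C.substConst j b).out = C.out.substConst j b := rfl

/-- **Node values after substitution** are the old node values on the input updated at `x_j`.
[folklore] -/
theorem nodeVal_substConst (x : Fin n → Bool) (w : Fin C.m → Bool) (v : Node n C.m) :
    C.nodeVal x w (v.substConst j b) = C.nodeVal (Function.update x j b) w v := by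
  cases v with
  | const b' => rfl
  | var i =>
    by_cases h : i = j
    · subst h
      rw [Node.substConst_var_self]
      simp [nodeVal]
    · rw [Node.substConst_var_of_ne h]
      simp [nodeVal, h]
  | gate k => rfl

/-- Node values are computed by the same function (same number of gates). [folklore] -/
theorem nodeVal_substConst_eq (x : Fin n → Bool) (w : Fin C.m → Bool) (v : Node n C.m) :
    (C.substConst j b).nodeVal x w v = C.nodeVal x w v := by
  cases v <;> rfl

/-- **Gate equations after substitution** are the old ones on the updated input. [folklore] -/
theorem consistent_substConst_iff (x : Fin n → Bool) (w : Fin C.m → Bool) :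
    (C.substConst j b).Consistent x w ↔ C.Consistent (Function.update x j b) w := by
  unfold Consistent
  simp only [nodeVal_substConst_eq, nodeVal_substConst]

variable {C} in
/-- **Constant substitution preserves fairness** (Li–Yang Prop. 2.6). [cite: LiYang2022, Prop. 2.6] -/
theorem Fair.substConst (hF : C.Fair) : (C.substConst j b).Fair := fun x => by
  obtain ⟨w, hw, huniq⟩ := hF (Function.update x j b)
  exact ⟨w, (C.consistent_substConst_iff j b x w).mpr hw,
    fun w' hw' => huniq w' ((C.consistent_substConst_iff j b x w').mp hw')⟩

/-- Out-degrees of gates are unchanged. [folklore] -/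
theorem fanout_substConst_gate (k : Fin C.m) :
    (C.substConst j b).fanout (.gate k) = C.fanout (.gate k) := by
  unfold fanout
  refine Finset.sum_congr rfl fun k' _ => ?_
  congr 1
  ext a
  simp [Node.substConst_eq_gate_iff]

/-- Out-degrees of the other variables are unchanged. [folklore] -/
theorem fanout_substConst_var_of_ne {i : Fin n} (h : i ≠ j) :
    (C.substConst j b).fanout (.var i) = C.fanout (.var i) := by
  unfold fanout
  refine Finset.sum_congr rfl fun k' _ => ?_
  congr 1
  ext a
  simp [Node.substConst_eq_var_iff, h]

/-- **The substituted variable becomes a `0`-variable.** [cite: LiYang2022, §2.4] -/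
theorem fanout_substConst_var_self : (C.substConst j b).fanout (.var j) = 0 := by
  unfold fanout
  refine Finset.sum_eq_zero fun k' _ => ?_
  rw [Finset.card_eq_zero, Finset.filter_eq_empty_iff]
  intro a _
  exact Node.substConst_ne_var_self j b _

variable {j b}

/-- A gate not reading `x_j` keeps its wires. [folklore] -/
theorem substConst_arg_of_not_reads {k : Fin C.m} (h : ∀ a, C.arg k a ≠ .var j) :
    (C.substConst j b).arg k = C.arg k :=
  funext fun a => Node.substConst_of_ne (h a) b

/-- A troubled gate of the substituted circuit does not read `x_j` (its wires are variables).
[folklore] -/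
theorem not_reads_of_troubled_substConst {k : Fin C.m} (hT : (C.substConst j b).Troubled k) :
    ∀ a, C.arg k a ≠ .var j := by
  obtain ⟨-, -, x, y, -, hr, -, -⟩ := hT
  intro a ha
  have hmem : (C.substConst j b).arg k a ∈ Set.range ((C.substConst j b).arg k) := ⟨a, rfl⟩
  rw [hr, substConst_arg, ha, Node.substConst_var_self] at hmem
  simp at hmem

/-- **Troubled gates after substitution**: the old troubled gates not reading `x_j`.
[cite: LiYang2022, Def. 3.1] -/
theorem troubled_substConst_iff (k : Fin C.m) :
    (C.substConst j b).Troubled k ↔ C.Troubled k ∧ ∀ a, C.arg k a ≠ .var j := by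
  constructor
  · intro hT
    have hnj := C.not_reads_of_troubled_substConst hT
    obtain ⟨hand, h1, x, y, hxy, hr, hx, hy⟩ := hT
    rw [C.substConst_arg_of_not_reads hnj] at hr
    have hxj : x ≠ j := by
      rintro rfl
      obtain ⟨a, ha⟩ : Node.var x ∈ Set.range (C.arg k) := by rw [hr]; simp
      exact hnj a ha
    have hyj : y ≠ j := by
      rintro rfl
      obtain ⟨a, ha⟩ : Node.var y ∈ Set.range (C.arg k) := by rw [hr]; simp
      exact hnj a ha
    rw [fanout_substConst_gate] at h1
    rw [C.fanout_substConst_var_of_ne _ _ hxj] at hx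
    rw [C.fanout_substConst_var_of_ne _ _ hyj] at hy
    exact ⟨⟨hand, h1, x, y, hxy, hr, hx, hy⟩, hnj⟩
  · rintro ⟨⟨hand, h1, x, y, hxy, hr, hx, hy⟩, hnj⟩
    have hxj : x ≠ j := by
      rintro rfl
      obtain ⟨a, ha⟩ : Node.var x ∈ Set.range (C.arg k) := by rw [hr]; simp
      exact hnj a ha
    have hyj : y ≠ j := by
      rintro rfl
      obtain ⟨a, ha⟩ : Node.var y ∈ Set.range (C.arg k) := by rw [hr]; simp
      exact hnj a ha
    refine ⟨hand, ?_, x, y, hxy, ?_, ?_, ?_⟩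
    · rw [fanout_substConst_gate]; exact h1
    · rw [C.substConst_arg_of_not_reads hnj]; exact hr
    · rw [C.fanout_substConst_var_of_ne _ _ hxj]; exact hx
    · rw [C.fanout_substConst_var_of_ne _ _ hyj]; exact hy

/-- A troubled gate of the substituted circuit was troubled. [folklore] -/
theorem troubled_of_troubled_substConst {k : Fin C.m} (hT : (C.substConst j b).Troubled k) :
    C.Troubled k :=
  ((C.troubled_substConst_iff k).mp hT).1

/-- **Substitution does not create troubled gates**: `t(C') ≤ t(C)`. [cite: LiYang2022, Def. 3.1] -/
theorem troubledCount_substConst_le : (C.substConst j b).troubledCount ≤ C.troubledCount := by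
  classical
  unfold troubledCount
  refine card_le_card fun k hk => ?_
  simp only [mem_filter, mem_univ, true_and] at hk ⊢
  exact C.troubled_of_troubled_substConst hk

/-! #### Packings and the potential under substitution -/

variable (j b)

open Classical in
/-- The packing after substitution: the packs whose two gates are still troubled. [cite: LiYang2022, Def. 3.3] -/
noncomputable def substConstPacking (P : Finset (Fin C.m × Fin C.m)) : Finset (Fin C.m × Fin C.m) :=
  P.filter fun p => (C.substConst j b).Troubled p.1 ∧ (C.substConst j b).Troubled p.2

variable {j b}

/-- Gates not reading `x_j` are adjacent after substitution iff they were. [folklore] -/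
theorem adjacent_substConst_iff {k k' : Fin C.m} (hk : ∀ a, C.arg k a ≠ .var j)
    (hk' : ∀ a, C.arg k' a ≠ .var j) :
    (C.substConst j b).Adjacent k k' ↔ C.Adjacent k k' := by
  unfold Adjacent
  rw [C.substConst_arg_of_not_reads hk, C.substConst_arg_of_not_reads hk']

variable {C} in
/-- **The filtered packing is a packing of the substituted circuit.** [cite: LiYang2022, Def. 3.3] -/
theorem IsPacking.substConst {P : Finset (Fin C.m × Fin C.m)} (hP : C.IsPacking P) :
    (C.substConst j b).IsPacking (C.substConstPacking j b P) := by
  classical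
  unfold substConstPacking
  refine ⟨fun p hp => ?_, fun p hp p' hp' hne => ?_⟩
  · rw [mem_filter] at hp
    obtain ⟨hp, hT1, hT2⟩ := hp
    obtain ⟨hne, -, -, hadj⟩ := hP.1 p hp
    refine ⟨hne, hT1, hT2, ?_⟩
    exact (C.adjacent_substConst_iff (C.not_reads_of_troubled_substConst hT1)
      (C.not_reads_of_troubled_substConst hT2)).mpr hadj
  · rw [mem_filter] at hp hp'
    exact hP.2 p hp.1 p' hp'.1 hne

variable {C} in
/-- **Substitution does not increase the potential**: with the filtered packing,
`Φ(C', 𝒫') ≤ Φ(C, 𝒫)` — every dropped pack contains a gate that stopped being troubled, and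
distinct packs contain distinct gates. [cite: LiYang2022, Def. 3.5] -/
theorem potential_substConst_le {P : Finset (Fin C.m × Fin C.m)} (hP : C.IsPacking P) :
    (C.substConst j b).potential (C.substConstPacking j b P) ≤ C.potential P := by
  classical
  unfold potential
  -- troubled sets
  set T : Finset (Fin C.m) := univ.filter fun k => C.Troubled k with hT
  set T' : Finset (Fin C.m) := univ.filter fun k => (C.substConst j b).Troubled k with hT'
  set P' := C.substConstPacking j b P with hP'
  have hTT' : T' ⊆ T := fun k hk => by
    simp only [hT, hT', mem_filter, mem_univ, true_and] at hk ⊢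
    exact C.troubled_of_troubled_substConst hk
  -- the dropped packs inject into the gates that stopped being troubled
  have hP'P : P' ⊆ P := filter_subset _ _
  let g : Fin C.m × Fin C.m → Fin C.m := fun p => if (C.substConst j b).Troubled p.1 then p.2 else p.1
  have hmaps : ∀ p ∈ P \ P', g p ∈ T \ T' := by
    intro p hp
    rw [mem_sdiff] at hp
    obtain ⟨hp, hnp⟩ := hp
    have hnp' : ¬ ((C.substConst j b).Troubled p.1 ∧ (C.substConst j b).Troubled p.2) := fun h =>
      hnp (mem_filter.mpr ⟨hp, h⟩)
    obtain ⟨-, hT1, hT2, -⟩ := hP.1 p hp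
    simp only [g, mem_sdiff, hT, hT', mem_filter, mem_univ, true_and]
    split_ifs with h1
    · exact ⟨hT2, fun h2 => hnp' ⟨h1, h2⟩⟩
    · exact ⟨hT1, h1⟩
  have hinj : Set.InjOn g (P \ P' : Finset _) := by
    intro p hp p' hp' hgg
    rw [Finset.coe_sdiff, Set.mem_sdiff] at hp hp'
    by_contra hne
    have hdis := hP.2 p hp.1 p' hp'.1 hne
    simp only [g] at hgg
    split_ifs at hgg with h1 h2 h2
    · exact hdis.2.2.2 hgg
    · exact hdis.2.2.1 hgg
    · exact hdis.2.1 hgg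
    · exact hdis.1 hgg
  have hcard : (P \ P').card ≤ (T \ T').card := card_le_card_of_injOn g hmaps hinj
  rw [card_sdiff_of_subset hP'P, card_sdiff_of_subset hTT'] at hcard
  have h1 : P'.card ≤ P.card := card_le_card hP'P
  have h2 : T'.card ≤ T.card := card_le_card hTT'
  have h3 : (C.substConst j b).troubledCount = T'.card := by
    unfold troubledCount; rw [hT']
  have h4 : C.troubledCount = T.card := by
    unfold troubledCount; rw [hT]
  rw [h3, h4]
  have h5 : P.card + T'.card ≤ T.card + P'.card := by omega
  have hc : (P.card : ℝ) + T'.card ≤ T.card + P'.card := by exact_mod_cast h5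
  linarith

/-! #### Computing `f|_R` and the measure under substitution -/

variable (j b) in
/-- The output value after substitution. [folklore] -/
theorem nodeVal_out_substConst (x : Fin n → Bool) (w : Fin C.m → Bool) :
    (C.substConst j b).nodeVal x w (C.substConst j b).out = C.nodeVal (Function.update x j b) w C.out := by
  rw [nodeVal_substConst_eq, substConst_out, nodeVal_substConst]

variable {C} in
/-- **Constant substitution computes `f` on the restricted source** (Li–Yang Prop. 2.6 for
constant substitutions): if `C` computes `f|_R` and `R'` is `R` with the extra equation
`x_j = c` (solutions `Sol R ∩ {x_j = c}`, free variables those of `R` except `x_j` — e.g.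
`R.assignFree j c` or `R.assignProtected … c`), then `C[x_j := c]` computes `f|_{R'}`.
[cite: LiYang2022, Prop. 2.6] -/
theorem ComputesRestr.substConst {f : (Fin n → ZMod 2) → Bool} {R R' : RdqSource n}
    (hC : C.ComputesRestr f R) {j : Fin n} {c : ZMod 2}
    (hsol : ∀ v, v ∈ R'.Sol ↔ v ∈ R.Sol ∧ v j = c) (hfree : ∀ i, R'.Free i ↔ R.Free i ∧ i ≠ j) :
    (C.substConst j (finTwoEquiv c)).ComputesRestr f R' := by
  refine ⟨fun i hi => ?_, fun v hv w hw => ?_⟩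
  · by_cases hij : i = j
    · subst hij
      exact C.fanout_substConst_var_self i _
    · rw [C.fanout_substConst_var_of_ne _ _ hij]
      exact hC.1 i fun hf => hi ((hfree i).mpr ⟨hf, hij⟩)
  · obtain ⟨hvR, hvj⟩ := (hsol v).mp hv
    have hx : Function.update (boolOfZMod2.symm v) j (finTwoEquiv c) = boolOfZMod2.symm v := by
      rw [← hvj]
      exact Function.update_eq_self j _
    rw [C.consistent_substConst_iff, hx] at hw
    rw [nodeVal_out_substConst, hx]
    exact hC.2 v hvR w hw

/-- **Influential inputs after substitution**: `x_j` is not influential (it is a `0`-variable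
and not free, hence unprotected); another variable is influential iff it was a `1⁺`-variable or
is protected in the new source. [cite: LiYang2022, Def. 3.6] -/
theorem mem_influential_substConst_iff {R' : RdqSource n} {j : Fin n} (hfreej : ¬ R'.Free j)
    (b : Bool) (i : Fin n) :
    i ∈ (C.substConst j b).influential R' ↔ i ≠ j ∧ (1 ≤ C.fanout (.var i) ∨ R'.Protected i) := by
  classical
  unfold influential
  rw [mem_filter]
  simp only [mem_univ, true_and]
  by_cases hij : i = j
  · subst hij
    rw [C.fanout_substConst_var_self]
    simp only [nonpos_iff_eq_zero, one_ne_zero, false_or, ne_eq, not_true_eq_false, false_and,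
      iff_false]
    exact fun hp => hfreej hp.1
  · rw [C.fanout_substConst_var_of_ne _ _ hij]
    simp [hij]

/-- The influential inputs after substitution are among the old ones other than `x_j`, provided
the new source protects no new variable. [cite: LiYang2022, Def. 3.6] -/
theorem influential_substConst_subset {R R' : RdqSource n} {j : Fin n} (hfreej : ¬ R'.Free j)
    (hprot : ∀ i, R'.Protected i → R.Protected i) (b : Bool) :
    (C.substConst j b).influential R' ⊆ (C.influential R).erase j := by
  classical
  intro i hi
  obtain ⟨hij, h⟩ := (C.mem_influential_substConst_iff hfreej b i).mp hi
  rw [mem_erase]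
  refine ⟨hij, ?_⟩
  unfold influential
  simp only [mem_filter, mem_univ, true_and]
  exact h.imp_right (hprot i)

variable {C} in
/-- **The measure after a constant substitution** (with the filtered packing): since the number
of gates is unchanged and the potential does not increase,
`μ(C', 𝒫', R') ≤ μ(C, 𝒫, R) - α_I (i - i') - α_Q (q - q')`. [cite: LiYang2022, Def. 3.6] -/
theorem measure_substConst_le {αφ : ℝ} (hφ : 0 ≤ αφ) (αI αQ : ℝ) {P : Finset (Fin C.m × Fin C.m)}
    (hP : C.IsPacking P) (R R' : RdqSource n) (j : Fin n) (b : Bool) :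
    (C.substConst j b).measure αφ αI αQ (C.substConstPacking j b P) R' ≤
      C.measure αφ αI αQ P R - αI * (((C.influential R).card : ℝ) - ((C.substConst j b).influential R').card)
        - αQ * ((R.quadCount : ℝ) - R'.quadCount) := by
  unfold measure
  have hpot := potential_substConst_le (j := j) (b := b) hP
  have hm : ((C.substConst j b).m : ℝ) = C.m := rfl
  rw [hm]
  nlinarith

end SubstConst

end Semicircuit

/-! ### The two constant substitutions, assembled -/

namespace Semicircuit

variable {n : ℕ} {C : Semicircuit n} {f : (Fin n → ZMod 2) → Bool} {R : RdqSource n}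

/-- **Constant substitution to an unprotected free variable** keeps computing `f` on the
restricted source `R.assignFree j c`. [cite: LiYang2022, Prop. 2.6] -/
theorem ComputesRestr.substConst_assignFree (hC : C.ComputesRestr f R) {j : Fin n}
    (hj : R.Free j) (hjp : ¬ R.Protected j) (c : ZMod 2) :
    (C.substConst j (finTwoEquiv c)).ComputesRestr f (R.assignFree j c hj hjp) :=
  hC.substConst (RdqSource.mem_sol_assignFree_iff hj hjp) (RdqSource.free_assignFree_iff hj hjp)

/-- **Constant substitution to a protected free variable** keeps computing `f` on the restricted
source `RdqSource.assignProtected he hr c`. [cite: LiYang2022, Prop. 2.6] -/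
theorem ComputesRestr.substConst_assignProtected (hC : C.ComputesRestr f R) {j l : Fin n}
    {e : QuadEq n} (he : R.quad l = some e) (hr : e.Reads j) (c : ZMod 2) :
    (C.substConst j (finTwoEquiv c)).ComputesRestr f (RdqSource.assignProtected he hr c) :=
  hC.substConst (RdqSource.mem_sol_assignProtected_iff he hr c)
    (RdqSource.free_assignProtected_iff he hr c)

variable (C)

/-- Influential inputs after a constant substitution to an unprotected variable: among the old
ones minus `x_j`. [cite: LiYang2022, Def. 3.6] -/
theorem influential_substConst_assignFree_subset {j : Fin n} (hj : R.Free j) (hjp : ¬ R.Protected j)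
    (c : ZMod 2) (b : Bool) :
    (C.substConst j b).influential (R.assignFree j c hj hjp) ⊆ (C.influential R).erase j :=
  C.influential_substConst_subset (fun h => ((RdqSource.free_assignFree_iff hj hjp j).mp h).2 rfl)
    (fun i hi => (RdqSource.protected_assignFree_iff hj hjp i).mp hi) b

/-- Influential inputs after a constant substitution to a protected variable: among the old
ones minus `x_j`; moreover the couple of `x_j` is influential afterwards only if it is a
`1⁺`-variable. [cite: LiYang2022, Def. 3.6] -/
theorem influential_substConst_assignProtected_subset {j l : Fin n} {e : QuadEq n}
    (he : R.quad l = some e) (hr : e.Reads j) (c : ZMod 2) (b : Bool) :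
    (C.substConst j b).influential (RdqSource.assignProtected he hr c) ⊆
      ((C.influential R).erase j).filter fun i => e.Reads i → 1 ≤ C.fanout (.var i) := by
  intro i hi
  have hfreej : ¬ (RdqSource.assignProtected he hr c).Free j := fun h =>
    ((RdqSource.free_assignProtected_iff he hr c j).mp h).2 rfl
  rw [mem_filter]
  refine ⟨C.influential_substConst_subset hfreej
    (fun i hi => RdqSource.protected_of_protected_assignProtected he hr c hi) b hi, fun hri => ?_⟩
  obtain ⟨-, h | h⟩ := (C.mem_influential_substConst_iff hfreej b i).mp hi
  · exact h
  · exact absurd h (RdqSource.not_protected_assignProtected_of_reads he hr c hri)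

/-- In the situation of the one-step claim (`dim R ≥ 2d + 2`), the circuit has at least one
gate. [cite: LiYang2022, proof of Thm. 4.1 (§4.1)] -/
theorem m_pos {d : ℕ} (hf : IsAffineDisperser f d) (hF : C.Fair) (hC : C.ComputesRestr f R)
    (hd : 2 * d + 2 ≤ R.dim) : 0 < C.m := by
  obtain ⟨k, -⟩ := C.exists_out_eq_gate hf hF hC hd
  exact k.pos

end Semicircuit

end Literature.Computability.Complexity
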